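import Summits.Ventures.LatticeQCDFlow.Exactness.Phi4MetropolisScan
import Literature.Analysis.FunctionSpaces.TorusLipschitzFourierH1
import HarnessLib

/-!
# CRITICAL SLOWING DOWN of the local Metropolis arm, typed: `τ_int,sweep(f) ≥ 2 Var(f)/(V δ²) − ½` for every coordinate-Lipschitz observable

HONEST FRAMING: exact (Metropolis-corrected) sampling algorithms for lattice gauge theory;
figures of merit are autocorrelation/cost numbers at stated couplings and volumes; no
continuum-physics claim.  (SCALAR calibration rung S0-A: not a gauge result.)

Venture `LatticeQCDFlow` (cell pub-lqcd), topic `Exactness`; FANOUT row 2 (`s0-phi4`, LOCAL arm —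
the row's "dynamical exponents z" deliverable, from the side of THEOREMS).  NEW WORK of the cell,
composing `Exactness/ReversibleLocalityFloor.lean` (`RevOp.thinned_tauInt_ge_of_carre_le`: the
sweep-unit locality floor for reversible samplers on an admissible class) with
`Exactness/Phi4MetropolisScan.lean` (row 2's random-site-scan Metropolis operator `metroScan J λ ρ`
is a reversible Markov `L²(e^{−S})`-contraction on bounded observables with carré du champ `≤ δ²`
under bounded proposals).  Nothing is cited as a fact.  Printed counterpart of the per-step
inequality, NAMED ONLY: Madras–Slade 1993, Cor. 9.2.3 (p. 304).  The physics reading —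
"local reversible dynamics has `τ_int(M) ≳ χ`, hence `z ≥ γ/ν`" — is folklore of the
critical-slowing-down literature (Sokal's lectures; Hohenberg–Halperin model A), named only; here it
is a theorem about row 2's sampler with explicit constants and hypotheses.

## What is proved (`Λ = Fin (n+1)`, `V = n+1` sites, `e^{−S}` the φ⁴ Gibbs weight, `λ > 0`, any `J`)

Step law `ρ`: an even probability density supported in `[−δ, δ]` (the engine's uniform window
`U[−δ, δ]`, `δ ≈ 0.5` on the AKS 2019 sets E1–E5, is the case in point; any such law is covered).
Observable `f`: bounded, measurable, and 1-LIPSCHITZ IN EACH COORDINATE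
(`|f(φ|φ_x:=t') − f(φ)| ≤ |t' − φ_x|`) — e.g. the CLIPPED MAGNETISATION `max(−N, min(N, Σ_x φ_x))`
for any clip level `N`, or any 1-Lipschitz function of it.  `g = f − ⟨f⟩`, `K = metroScan J λ ρ`,
`ρ_g(k) = ∫ g (Kᵏ g) e^{−S} / ∫ g² e^{−S}`; one SWEEP = `V` random site updates.

* `sq_sub_le_of_coordLipschitz` — the move bound: a proposal the window can make changes `g` by at
  most `δ` (`ρ(t' − φ_x) ≠ 0 ⇒ (g(φ|φ_x:=t') − g φ)² ≤ δ²`);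
* **`metropolisScan_tauInt_sweep_ge`** — if the sweep-thinned autocorrelation series of `g` is
  summable and `ρ_g(V) < 1`, then
  `τ_int,sweep(f) = ½ + Σ_{k≥1} ρ_g(Vk) ≥ 2 Var(f) / (V δ²) − ½`,  `Var(f) = ⟨(f − ⟨f⟩)²⟩`;
* `sum_update_sub_sum`, `clipMag_bddObs`, `clipMag_coordLipschitz` (the clamp's 1-Lipschitz property is
  `Literature.Analysis.FunctionSpaces.abs_clamp_sub_clamp_le`) and
  **`metropolisScan_tauInt_sweep_ge_clipMag`** — the instance `f = max(−N, min(N, Σ_x φ_x))`: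
  `τ_int,sweep ≥ 2 Var(clip_N M)/(V δ²) − ½` for EVERY clip level `N`.

Reading (no numerics implied).  `Var(clip_N M)/V → Var(M)/V = χ` (the susceptibility) as `N → ∞`,
so in sweeps the random-scan local Metropolis arm cannot decorrelate the magnetisation faster than
`τ_int ≳ 2χ/δ² − ½`: at `δ = 0.5` that is `8χ − ½` sweeps, and wherever `χ` grows like `L^{γ/ν}`
the arm's dynamical exponent for `M` obeys `z_int,M ≥ γ/ν` — the typed mechanism of critical slowing
down (and of two-phase tunnelling: in a double-well regime `Var(M) ≈ V²m²`, floor `≈ 2Vm²/δ²`).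
NOT CLAIMED: the ordered (lexicographic) sweep the engine runs (not reversible — only its random-scan
form is covered); `ρ_g(V) < 1` / summability for any run (hypotheses); any value of `χ`; HMC or the
flow arm (their moves are not local — no such floor); the unclipped `M` (square-integrable but
unbounded: the admissible-class framework `RevOp` is ready for it, the lattice-side envelope
estimates are the remaining step).
-/

namespace Summit.Ventures.LatticeQCDFlow.Exactness

open Real MeasureTheory Filter Finset
open Summit.Ventures.LatticeQCDFlow.Scoring

section CSD

variable {n : ℕ}

/-- **The move bound.**  If `f` is 1-Lipschitz in each coordinate and the step law vanishes outside
`[−δ, δ]`, then every proposal it can make changes `g = f − c` by at most `δ` in absolute value: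
`ρ(t' − φ_x) ≠ 0 ⇒ (g(φ|φ_x:=t') − g φ)² ≤ δ²`. -/
theorem sq_sub_le_of_coordLipschitz {ρ : ℝ → ℝ} {δ : ℝ} (hρδ : ∀ u, δ < |u| → ρ u = 0)
    {f : (Fin (n + 1) → ℝ) → ℝ}
    (hlip : ∀ (φ : Fin (n + 1) → ℝ) (x : Fin (n + 1)) (t' : ℝ),
      |f (Function.update φ x t') - f φ| ≤ |t' - φ x|)
    (c : ℝ) (φ : Fin (n + 1) → ℝ) (x : Fin (n + 1)) (t' : ℝ) (hne : ρ (t' - φ x) ≠ 0) :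
    ((f (Function.update φ x t') - c) - (f φ - c)) ^ 2 ≤ δ ^ 2 := by
  have hle : |t' - φ x| ≤ δ := by
    by_contra h
    exact hne (hρδ _ (lt_of_not_ge h))
  have h1 : |f (Function.update φ x t') - f φ| ≤ δ := (hlip φ x t').trans hle
  have e : (f (Function.update φ x t') - c) - (f φ - c) = f (Function.update φ x t') - f φ := by ring
  rw [e, ← sq_abs]
  exact pow_le_pow_left₀ (abs_nonneg _) h1 2

/-- **CRITICAL SLOWING DOWN OF THE RANDOM-SCAN LOCAL METROPOLIS ARM (sweep units).**
Lattice φ⁴ on `ℝ^Λ`, `Λ = Fin (n+1)`, every `λ > 0`, every real coupling matrix `J`; step law `ρ` an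
even probability density vanishing outside `[−δ, δ]`; `f` bounded measurable and 1-Lipschitz in each
coordinate; `g = f − ⟨f⟩`; `K` the random-site-scan Metropolis operator; one sweep = `n+1` site
updates.  If the sweep-thinned autocorrelation series of `g` is summable and `ρ_g(n+1) < 1`, then
`τ_int,sweep = ½ + Σ_{k≥1} ρ_g((n+1)k) ≥ 2 ⟨(f − ⟨f⟩)²⟩ / ((n+1) δ²) − ½`. -/
theorem metropolisScan_tauInt_sweep_ge {lam : ℝ} (hlam : 0 < lam) (J : Fin (n + 1) → Fin (n + 1) → ℝ)
    {ρ : ℝ → ℝ} (hρ0 : ∀ u, 0 ≤ ρ u) (hρm : Measurable ρ) (hρi : Integrable ρ)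
    (hρ1 : ∫ u, ρ u = 1) (hρs : ∀ u, ρ (-u) = ρ u) {δ : ℝ} (hρδ : ∀ u, δ < |u| → ρ u = 0)
    {f : (Fin (n + 1) → ℝ) → ℝ} (hf : BddObs f)
    (hlip : ∀ (φ : Fin (n + 1) → ℝ) (x : Fin (n + 1)) (t' : ℝ),
      |f (Function.update φ x t') - f φ| ≤ |t' - φ x|)
    (hs : Summable fun k => (∫ φ, (f φ - gibbsExpect J lam f)
        * ((metroScan J lam ρ)^[(n + 1) * (k + 1)] (fun ψ => f ψ - gibbsExpect J lam f)) φ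
        * gibbsWeight J lam φ) / ∫ φ, (f φ - gibbsExpect J lam f) ^ 2 * gibbsWeight J lam φ)
    (hρV : (∫ φ, (f φ - gibbsExpect J lam f)
        * ((metroScan J lam ρ)^[n + 1] (fun ψ => f ψ - gibbsExpect J lam f)) φ * gibbsWeight J lam φ)
        / (∫ φ, (f φ - gibbsExpect J lam f) ^ 2 * gibbsWeight J lam φ) < 1) :
    2 * gibbsExpect J lam (fun φ => (f φ - gibbsExpect J lam f) ^ 2) / ((n + 1) * δ ^ 2) - 1 / 2
      ≤ tauInt (fun k => (∫ φ, (f φ - gibbsExpect J lam f)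
          * ((metroScan J lam ρ)^[(n + 1) * k] (fun ψ => f ψ - gibbsExpect J lam f)) φ
          * gibbsWeight J lam φ) / ∫ φ, (f φ - gibbsExpect J lam f) ^ 2 * gibbsWeight J lam φ) := by
  have hco := latticePhi4Action_coercive hlam J
  obtain ⟨hfm, B, hfb⟩ := hf
  obtain ⟨hgm, hgb, -⟩ := centred_observable hlam J hfm hfb
  have hg : BddObs (fun ψ => f ψ - gibbsExpect J lam f) := ⟨hgm, _, hgb⟩
  have hΓ : ∀ φ, metroScan J lam ρ (fun ψ => ((f ψ - gibbsExpect J lam f)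
      - (f φ - gibbsExpect J lam f)) ^ 2) φ ≤ δ ^ 2 := fun φ =>
    metroScan_sq_dev_le J lam hρ0 hρi hρ1 φ fun x t' hne =>
      sq_sub_le_of_coordLipschitz hρδ hlip (gibbsExpect J lam f) φ x t' hne
  have hfloor := RevOp.thinned_tauInt_ge_of_carre_le (μ := volume) (A := BddObs)
    (K := metroScan J lam ρ) (w := gibbsWeight J lam)
    (fun φ => (gibbsWeight_pos J lam φ).le) (bddObs_const 1)
    (fun f h hf hh => bddObs_integrable_mul_mul_gibbsWeight one_pos hco hf hh)
    (fun f h c hf hh => bddObs_add_mul hf hh c)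
    (fun f hf => bddObs_metroScan J lam hρ0 hρm hρi hρ1 hf)
    (fun f h c hf hh x => metroScan_add_mul J lam hρ0 hρm hρi hf hh c x)
    (fun f h hf hh => metroScan_reversible one_pos hco hρ0 hρm hρi hρ1 hρs hf hh)
    (fun f hf => metroScan_contraction one_pos hco hρ0 hρm hρi hρ1 hρs hf)
    (fun φ => metroScan_one J lam hρ1 φ) hg (bddObs_sq hg) hΓ (show 0 < n + 1 by omega) hs hρV
  -- identify `2 ⟨g²⟩ / (V δ²)` with `2 ∫g²w / (V δ² Z)` (`⟨·⟩ = ∫ · e^{−S} / Z` by definition)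
  have e : ∀ P Z : ℝ, 2 * (P / Z) / (((n : ℝ) + 1) * δ ^ 2) - 1 / 2
      = 2 * P / (((n + 1 : ℕ) : ℝ) * δ ^ 2 * Z) - 1 / 2 := by
    intro P Z
    push_cast
    rw [← mul_div_assoc, div_div, mul_comm Z]
  exact (e _ _).le.trans hfloor

/-- A single-site update moves the magnetisation by the increment: `Σ (φ|φ_x:=t') − Σ φ = t' − φ_x`. -/
theorem sum_update_sub_sum (φ : Fin (n + 1) → ℝ) (x : Fin (n + 1)) (t' : ℝ) :
    (∑ y, Function.update φ x t' y) - ∑ y, φ y = t' - φ x := by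
  rw [Finset.sum_update_of_mem (Finset.mem_univ x),
    Finset.sum_eq_add_sum_sdiff_singleton_of_mem (Finset.mem_univ x) φ]
  ring

/-- The clipped magnetisation `max(−N, min(N, Σ_x φ_x))` is a bounded measurable observable. -/
theorem clipMag_bddObs (N : ℝ) :
    BddObs (fun φ : Fin (n + 1) → ℝ => max (-N) (min N (∑ y, φ y))) := by
  refine ⟨?_, |N|, fun φ => ?_⟩
  · exact measurable_const.max (measurable_const.min (Finset.measurable_sum _ fun y _ =>
      measurable_pi_apply y))
  · show |max (-N) (min N (∑ y, φ y))| ≤ |N|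
    refine abs_le.mpr ⟨?_, ?_⟩
    · exact (neg_le_neg (le_abs_self N)).trans (le_max_left _ _)
    · exact max_le (neg_le_abs N) ((min_le_left N _).trans (le_abs_self N))

/-- The clipped magnetisation is 1-Lipschitz in each coordinate. -/
theorem clipMag_coordLipschitz (N : ℝ) (φ : Fin (n + 1) → ℝ) (x : Fin (n + 1)) (t' : ℝ) :
    |max (-N) (min N (∑ y, Function.update φ x t' y)) - max (-N) (min N (∑ y, φ y))|
      ≤ |t' - φ x| := by
  rw [← sum_update_sub_sum φ x t']
  exact Literature.Analysis.FunctionSpaces.abs_clamp_sub_clamp_le N _ _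

/-- **THE CRITICAL-SLOWING-DOWN FLOOR FOR THE (CLIPPED) MAGNETISATION.**  Every `λ > 0`, every
real `J`, every even step density `ρ` vanishing outside `[−δ, δ]`, every clip level `N`; with
`f_N = max(−N, min(N, Σ_x φ_x))`, `g = f_N − ⟨f_N⟩`, `K` the random-site-scan Metropolis operator
and one sweep = `n+1` site updates: if the sweep-thinned autocorrelation series of `g` is summable
and `ρ_g(n+1) < 1`, then `τ_int,sweep(f_N) ≥ 2 Var(f_N)/((n+1) δ²) − ½`
(`Var(f_N)/(n+1) → χ`, the susceptibility, as `N → ∞`). -/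
theorem metropolisScan_tauInt_sweep_ge_clipMag {lam : ℝ} (hlam : 0 < lam)
    (J : Fin (n + 1) → Fin (n + 1) → ℝ) {ρ : ℝ → ℝ} (hρ0 : ∀ u, 0 ≤ ρ u) (hρm : Measurable ρ)
    (hρi : Integrable ρ) (hρ1 : ∫ u, ρ u = 1) (hρs : ∀ u, ρ (-u) = ρ u) {δ : ℝ}
    (hρδ : ∀ u, δ < |u| → ρ u = 0) (N : ℝ)
    (hs : Summable fun k => (∫ φ, (max (-N) (min N (∑ y, φ y))
          - gibbsExpect J lam (fun ψ => max (-N) (min N (∑ y, ψ y))))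
        * ((metroScan J lam ρ)^[(n + 1) * (k + 1)] (fun ψ => max (-N) (min N (∑ y, ψ y))
          - gibbsExpect J lam (fun ψ => max (-N) (min N (∑ y, ψ y))))) φ * gibbsWeight J lam φ)
        / ∫ φ, (max (-N) (min N (∑ y, φ y))
          - gibbsExpect J lam (fun ψ => max (-N) (min N (∑ y, ψ y)))) ^ 2 * gibbsWeight J lam φ)
    (hρV : (∫ φ, (max (-N) (min N (∑ y, φ y))
          - gibbsExpect J lam (fun ψ => max (-N) (min N (∑ y, ψ y))))
        * ((metroScan J lam ρ)^[n + 1] (fun ψ => max (-N) (min N (∑ y, ψ y))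
          - gibbsExpect J lam (fun ψ => max (-N) (min N (∑ y, ψ y))))) φ * gibbsWeight J lam φ)
        / (∫ φ, (max (-N) (min N (∑ y, φ y))
          - gibbsExpect J lam (fun ψ => max (-N) (min N (∑ y, ψ y)))) ^ 2 * gibbsWeight J lam φ)
        < 1) :
    2 * gibbsExpect J lam (fun φ => (max (-N) (min N (∑ y, φ y))
          - gibbsExpect J lam (fun ψ => max (-N) (min N (∑ y, ψ y)))) ^ 2) / ((n + 1) * δ ^ 2)
        - 1 / 2
      ≤ tauInt (fun k => (∫ φ, (max (-N) (min N (∑ y, φ y))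
          - gibbsExpect J lam (fun ψ => max (-N) (min N (∑ y, ψ y))))
        * ((metroScan J lam ρ)^[(n + 1) * k] (fun ψ => max (-N) (min N (∑ y, ψ y))
          - gibbsExpect J lam (fun ψ => max (-N) (min N (∑ y, ψ y))))) φ * gibbsWeight J lam φ)
        / ∫ φ, (max (-N) (min N (∑ y, φ y))
          - gibbsExpect J lam (fun ψ => max (-N) (min N (∑ y, ψ y)))) ^ 2 * gibbsWeight J lam φ) :=
  metropolisScan_tauInt_sweep_ge hlam J hρ0 hρm hρi hρ1 hρs hρδ (clipMag_bddObs N)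
    (fun φ x t' => clipMag_coordLipschitz N φ x t') hs hρV

end CSD

end Summit.Ventures.LatticeQCDFlow.Exactness
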